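import Summits.QuantumFields.YangMills.Theorems.FluctuationComparisonRegPrIntLS2BetaSizeLipschitzByCauchy
import Summits.QuantumFields.YangMills.Theorems.FluctuationComparisonRegPrIntLS2BetaChainCouplingCost
import HarnessLib

/-!
# S2β · letter (D♮) REL-TEL, the (C)-half — THE ANALYTIC HALF BY THE CAUCHY ROAD (UV3-NODE §82.3 (R-Cauchy)), FILE 2:
# THE RELATIVE CHAIN-COUPLING LETTER (✓G14's `O(size)`-Lipschitz edition)
# `‖J₁₄(a′,b′,c′,d′,H′) − J₁₄(a,b,c,d,H)‖ ≤ 4096·((e^{24ρ}−1)+(e^{16ρ}−1)+(e^{8ρ}−1))·δ` (two tuples of size `≤ ρ ≤ 1∕800`; `δ` ANY bound on the sup of the differences)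

Cell `ym3-torus` (rung R3 = continuum `SU(2)` Yang–Mills on the three-torus — NOT d = 4, NOT infinite volume, NOT a mass gap, NOT Clay).
Width seat «width 10» `ym3-torus-px10` (gen 23), FREE px helper on crux `stmt-QuantumFields-20520`, count-neutral, DEFINITION-FREE; own-risk brick of the px10 lane
«(C)-half of letter (D♮)».  Companion of ✓`…S2BetaSizeLipschitzByCauchy` (the device + the relative HYBRID ×4 letter); this file treats the other analytic letter of the
(C)-STEP ✓`…S2BetaOneLevelStep`, the CHAIN COUPLING ✓G14 `…S2BetaChainCouplingCost.norm_chain4_sub_nestedMean4_le`: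
`J₁₄(a,b,c,d,H) := mean_i log(e^{a i}e^{b(σ₁i)}e^{c(σ₂σ₁i)}e^{d(σ₃σ₂σ₁i)}H) − mean⁴_{ijkl} log(e^{a i}e^{b j}e^{c k}e^{d l}H)` (any three permutations).

THE POINT.  For the RELATIVE (C)-step the absolute letter's LOCAL structure is not needed: on the sup-ball of radius `r` about a tuple of size `ρ` every member has size
`≤ ρ′ := ρ + r`, the spreads are `≤ 2ρ′` and the local means (centres `1`) are `≤ e^{kρ′} − 1`, so ✓G14 bounds `‖J₁₄‖ ≤ M(ρ′)` on the whole ball, a SECOND-ORDER quantity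
`O(ρ′²)`; the two-point Schwarz device on the half ball about the IDENTITY tuple (✓`norm_sub_le_on_half_ball`, radius `8ρ`) turns it into
`‖J₁₄(p′) − J₁₄(p)‖ ≤ 4096·((e^{24ρ}−1)+(e^{16ρ}−1)+(e^{8ρ}−1))·δ` with `δ` ANY bound on the SUP of the member∕context differences — Lipschitz constant `O(ρ)` = THE SIZE, no
closeness of the tuples needed, and `δ` is the local relative datum.  ★★★ `norm_chain4_sub_chain4_le`.

HONEST SCOPE.  One Schwarz call + differentiability bookkeeping (reusing FILE 1's) + ✓G14 on a larger ball; nothing of Bałaban's renormalisation analysis is asserted; the relative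
(C)-step's assembly, the relative key lemma, (D♮), (F♮), GAP♯∘ (`stub_uniformFibreGapOrbit`), S2β, crux 20520 and `YM3TorusSU2` are NOT proved; no registered stub is closed; the
Yang–Mills mass gap is NOT proved.  Sorry-free, axioms standard.
References: T. Bałaban, CMP **98** (1985) 17–51 [Balaban1985Averaging] ((21) p.21, (26)–(27) p.22); CMP **109** (1987) 249–301 [Balaban1987RG1] (§3 (3.15)–(3.17) p.288).
-/

set_option autoImplicit false

noncomputable section

namespace Summit.QuantumFields.YangMills.Theorems.FluctuationComparisonRegPrIntLS2BetaRelativeChainCoupling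

open NormedSpace Finset Metric
open scoped BigOperators
open Literature.MathematicalPhysics.QuantumFieldTheory.Balaban1983to89.MatrixLog (mlog analyticAt_mlog)
open Literature.Analysis.Calculus.BCH (norm_mul_sub_one_le_of_le)
open Literature.Analysis.Calculus.ExpDifferential (norm_exp_sub_one_le_exp_norm_sub_one)
open Summit.QuantumFields.YangMills.Theorems.FluctuationComparisonRegPrIntLS2BetaHybridFourSlot (norm_mean_le norm_prod_sub_one_le₂ norm_prod_sub_one_le₃)
open Summit.QuantumFields.YangMills.Theorems.FluctuationComparisonRegPrIntLS2BetaChainCouplingCost (norm_chain4_sub_nestedMean4_le)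
open Summit.QuantumFields.YangMills.Theorems.FluctuationComparisonRegPrIntLS2BetaSizeLipschitzByCauchy (norm_sub_le_on_half_ball norm_word4_sub_one_lt_one
  differentiable_exp sizes_on_ball sizes_on_ball_one mem_ball_one_of_sizes)

variable {𝔸 : Type*} [NormedRing 𝔸] [NormedAlgebra ℂ 𝔸] [CompleteSpace 𝔸] [NormOneClass 𝔸]
variable {ι : Type*} [Fintype ι] [Nonempty ι]

/-! ## §1 Differentiability of the chain-coupling map on the small ball -/

omit [NormOneClass 𝔸] in
/-- ★ The CHAIN-COUPLING map `p ↦ mean_i log(e^{a i}e^{b(σ₁i)}e^{c(σ₂σ₁i)}e^{d(σ₃σ₂σ₁i)}H) − mean⁴ log(e^{a i}e^{b j}e^{c k}e^{d l}H)` is ℂ-differentiable on the sup-ball of radius `r`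
about a tuple of size `ρ`, `ρ + r ≤ 1∕100` (every word inside `log`'s ball; lit ✓`analyticAt_mlog`, Mathlib `NormedSpace.exp_analytic`). [cite: Balaban1985Averaging, (21) p.21] -/
theorem differentiableOn_chain4 {p₀ : (ι → 𝔸) × (ι → 𝔸) × (ι → 𝔸) × (ι → 𝔸) × 𝔸} {ρ r : ℝ} (hr : 0 ≤ r) (hρr : ρ + r ≤ 1 / 100)
    (ha : ∀ i, ‖p₀.1 i‖ ≤ ρ) (hb : ∀ i, ‖p₀.2.1 i‖ ≤ ρ) (hc : ∀ i, ‖p₀.2.2.1 i‖ ≤ ρ) (hd : ∀ i, ‖p₀.2.2.2.1 i‖ ≤ ρ)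
    (hH : ‖p₀.2.2.2.2 - 1‖ ≤ Real.exp ρ - 1) (σ₁ σ₂ σ₃ : Equiv.Perm ι) :
    DifferentiableOn ℂ (fun p : (ι → 𝔸) × (ι → 𝔸) × (ι → 𝔸) × (ι → 𝔸) × 𝔸 =>
      ((Fintype.card ι : ℝ))⁻¹ • ∑ i, mlog (exp (p.1 i) * exp (p.2.1 (σ₁ i)) * exp (p.2.2.1 (σ₂ (σ₁ i))) * exp (p.2.2.2.1 (σ₃ (σ₂ (σ₁ i)))) * p.2.2.2.2) -
        ((Fintype.card ι : ℝ))⁻¹ • ∑ i, ((Fintype.card ι : ℝ))⁻¹ • ∑ j, ((Fintype.card ι : ℝ))⁻¹ • ∑ k, ((Fintype.card ι : ℝ))⁻¹ • ∑ l,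
          mlog (exp (p.1 i) * exp (p.2.1 j) * exp (p.2.2.1 k) * exp (p.2.2.2.1 l) * p.2.2.2.2)) (ball p₀ r) := by
  intro p hp
  obtain ⟨ha', hb', hc', hd', hH'⟩ := sizes_on_ball hr ha hb hc hd hH hp
  have hexp : Differentiable ℂ (exp : 𝔸 → 𝔸) := differentiable_exp
  have hA : ∀ i, Differentiable ℂ (fun p : (ι → 𝔸) × (ι → 𝔸) × (ι → 𝔸) × (ι → 𝔸) × 𝔸 => p.1 i) := fun i => by fun_prop
  have hB : ∀ i, Differentiable ℂ (fun p : (ι → 𝔸) × (ι → 𝔸) × (ι → 𝔸) × (ι → 𝔸) × 𝔸 => p.2.1 i) := fun i => by fun_prop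
  have hC : ∀ i, Differentiable ℂ (fun p : (ι → 𝔸) × (ι → 𝔸) × (ι → 𝔸) × (ι → 𝔸) × 𝔸 => p.2.2.1 i) := fun i => by fun_prop
  have hD : ∀ i, Differentiable ℂ (fun p : (ι → 𝔸) × (ι → 𝔸) × (ι → 𝔸) × (ι → 𝔸) × 𝔸 => p.2.2.2.1 i) := fun i => by fun_prop
  have hHd : Differentiable ℂ (fun p : (ι → 𝔸) × (ι → 𝔸) × (ι → 𝔸) × (ι → 𝔸) × 𝔸 => p.2.2.2.2) := by fun_prop
  have hw : ∀ i j k l, Differentiable ℂ (fun p : (ι → 𝔸) × (ι → 𝔸) × (ι → 𝔸) × (ι → 𝔸) × 𝔸 =>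
      exp (p.1 i) * exp (p.2.1 j) * exp (p.2.2.1 k) * exp (p.2.2.2.1 l) * p.2.2.2.2) := fun i j k l =>
    ((((hexp.comp (hA i)).mul (hexp.comp (hB j))).mul (hexp.comp (hC k))).mul (hexp.comp (hD l))).mul hHd
  have hlogw : ∀ i j k l, DifferentiableAt ℂ (fun p : (ι → 𝔸) × (ι → 𝔸) × (ι → 𝔸) × (ι → 𝔸) × 𝔸 =>
      mlog (exp (p.1 i) * exp (p.2.1 j) * exp (p.2.2.1 k) * exp (p.2.2.2.1 l) * p.2.2.2.2)) p := fun i j k l => by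
    have hin := norm_word4_sub_one_lt_one hρr (ha' i) (hb' j) (hc' k) (hd' l) hH'
    show DifferentiableAt ℂ ((mlog : 𝔸 → 𝔸) ∘ fun p : (ι → 𝔸) × (ι → 𝔸) × (ι → 𝔸) × (ι → 𝔸) × 𝔸 =>
      exp (p.1 i) * exp (p.2.1 j) * exp (p.2.2.1 k) * exp (p.2.2.2.1 l) * p.2.2.2.2) p
    exact (analyticAt_mlog hin).differentiableAt.comp p (hw i j k l p)
  have hchain : DifferentiableAt ℂ (fun p : (ι → 𝔸) × (ι → 𝔸) × (ι → 𝔸) × (ι → 𝔸) × 𝔸 =>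
      ((Fintype.card ι : ℝ))⁻¹ • ∑ i, mlog (exp (p.1 i) * exp (p.2.1 (σ₁ i)) * exp (p.2.2.1 (σ₂ (σ₁ i))) * exp (p.2.2.2.1 (σ₃ (σ₂ (σ₁ i)))) * p.2.2.2.2)) p :=
    (DifferentiableAt.fun_sum fun i _ => hlogw i (σ₁ i) (σ₂ (σ₁ i)) (σ₃ (σ₂ (σ₁ i)))).const_smul _
  have hM4 : DifferentiableAt ℂ (fun p : (ι → 𝔸) × (ι → 𝔸) × (ι → 𝔸) × (ι → 𝔸) × 𝔸 =>
      ((Fintype.card ι : ℝ))⁻¹ • ∑ i, ((Fintype.card ι : ℝ))⁻¹ • ∑ j, ((Fintype.card ι : ℝ))⁻¹ • ∑ k, ((Fintype.card ι : ℝ))⁻¹ • ∑ l,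
        mlog (exp (p.1 i) * exp (p.2.1 j) * exp (p.2.2.1 k) * exp (p.2.2.2.1 l) * p.2.2.2.2)) p := by
    refine (DifferentiableAt.fun_sum fun i _ => ?_).const_smul _
    refine (DifferentiableAt.fun_sum fun j _ => ?_).const_smul _
    refine (DifferentiableAt.fun_sum fun k _ => ?_).const_smul _
    refine (DifferentiableAt.fun_sum fun l _ => ?_).const_smul _
    exact hlogw i j k l
  exact (hchain.sub hM4).differentiableWithinAt

/-! ## §2 The absolute chain-coupling bound on the whole ball, from the sizes alone -/

/-- ★ **✓G14 ON THE BALL, CRUDE FORM**: at sizes `≤ ρ′ ≤ 1∕100` and context `‖H − 1‖ ≤ e^{ρ′} − 1`, with the three centres `1` and the spreads `2ρ′`: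
`‖J₁₄(a,b,c,d,H)‖ ≤ 1024·ρ′·((e^{3ρ′} − 1) + (e^{2ρ′} − 1) + (e^{ρ′} − 1))` — a SECOND-ORDER quantity `O(ρ′²)`. [cite: Balaban1985Averaging, (26)-(27) p.22] -/
theorem norm_chain4_le_of_sizes (a b c d : ι → 𝔸) (H : 𝔸) {ρ' : ℝ} (hρ : ρ' ≤ 1 / 100)
    (ha : ∀ i, ‖a i‖ ≤ ρ') (hb : ∀ i, ‖b i‖ ≤ ρ') (hc : ∀ i, ‖c i‖ ≤ ρ') (hd : ∀ i, ‖d i‖ ≤ ρ') (hH : ‖H - 1‖ ≤ Real.exp ρ' - 1)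
    (σ₁ σ₂ σ₃ : Equiv.Perm ι) :
    ‖((Fintype.card ι : ℝ))⁻¹ • ∑ i, mlog (exp (a i) * exp (b (σ₁ i)) * exp (c (σ₂ (σ₁ i))) * exp (d (σ₃ (σ₂ (σ₁ i)))) * H) -
        ((Fintype.card ι : ℝ))⁻¹ • ∑ i, ((Fintype.card ι : ℝ))⁻¹ • ∑ j, ((Fintype.card ι : ℝ))⁻¹ • ∑ k, ((Fintype.card ι : ℝ))⁻¹ • ∑ l,
          mlog (exp (a i) * exp (b j) * exp (c k) * exp (d l) * H)‖ ≤
      1024 * ρ' * ((Real.exp (3 * ρ') - 1) + (Real.exp (2 * ρ') - 1) + (Real.exp ρ' - 1)) := by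
  have hρ0 : 0 ≤ ρ' := (norm_nonneg _).trans (ha (Classical.arbitrary ι))
  have hs : ∀ (f : ι → 𝔸), (∀ i, ‖f i‖ ≤ ρ') → ∀ j j', ‖f j - f j'‖ ≤ 2 * ρ' := fun f hf j j' =>
    (norm_sub_le _ _).trans (by linarith [hf j, hf j'])
  have hG := norm_chain4_sub_nestedMean4_le a b c d H hρ ha hb hc hd hH σ₁ σ₂ σ₃ 1 1 1 (hs b hb) (hs c hc) (hs d hd)
  have he : ∀ {u : 𝔸}, ‖u‖ ≤ ρ' → ‖exp u - 1‖ ≤ Real.exp ρ' - 1 := fun hu =>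
    (norm_exp_sub_one_le_exp_norm_sub_one _).trans (by gcongr)
  -- the three local means, crudely by the sizes (a uniform mean of terms `≤ b` is `≤ b`)
  have mean_le : ∀ (f : ι → ℝ) {b : ℝ}, (∀ i, f i ≤ b) → ((Fintype.card ι : ℝ))⁻¹ * ∑ i, f i ≤ b := fun f b hf => by
    have hc0 : (0 : ℝ) < Fintype.card ι := Nat.cast_pos.mpr Fintype.card_pos
    rw [inv_mul_le_iff₀ hc0]
    calc ∑ i, f i ≤ ∑ _i : ι, b := Finset.sum_le_sum fun i _ => hf i
      _ = (Fintype.card ι : ℝ) * b := by rw [Finset.sum_const, Finset.card_univ, nsmul_eq_mul]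
  have hm₁ : ((Fintype.card ι : ℝ))⁻¹ * ∑ i, ‖exp (a i) - 1‖ ≤ Real.exp ρ' - 1 :=
    mean_le _ fun i => he (ha i)
  have hm₂ : ((Fintype.card ι : ℝ))⁻¹ * ∑ i, ‖exp (a (σ₁.symm i)) * exp (b i) - 1‖ ≤ Real.exp (2 * ρ') - 1 :=
    mean_le _ fun i => norm_prod_sub_one_le₂ (he (ha _)) (he (hb _))
  have hm₃ : ((Fintype.card ι : ℝ))⁻¹ * ∑ i, ‖exp (a (σ₁.symm (σ₂.symm i))) * exp (b (σ₂.symm i)) * exp (c i) - 1‖ ≤ Real.exp (3 * ρ') - 1 :=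
    mean_le _ fun i => norm_prod_sub_one_le₃ (he (ha _)) (he (hb _)) (he (hc _))
  have e1 : 0 ≤ Real.exp ρ' - 1 := by linarith [Real.add_one_le_exp ρ']
  have e2 : 0 ≤ Real.exp (2 * ρ') - 1 := by linarith [Real.add_one_le_exp (2 * ρ')]
  have e3 : 0 ≤ Real.exp (3 * ρ') - 1 := by linarith [Real.add_one_le_exp (3 * ρ')]
  have k0 : (0 : ℝ) ≤ 2 * 256 * (2 * ρ') := by positivity
  have k₁ := mul_le_mul_of_nonneg_left hm₁ k0
  have k₂ := mul_le_mul_of_nonneg_left hm₂ k0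
  have k₃ := mul_le_mul_of_nonneg_left hm₃ k0
  refine hG.trans ?_
  nlinarith [k₁, k₂, k₃, e1, e2, e3, hρ0]

/-! ## §3 The relative chain-coupling letter -/

/-- ★★★ **THE RELATIVE CHAIN-COUPLING LETTER** (✓G14's `O(size)`-Lipschitz edition, by Cauchy): two member tuples `a,b,c,d` and `a′,b′,c′,d′ : ι → 𝔸` of size `≤ ρ`, contexts
`‖H − 1‖, ‖H′ − 1‖ ≤ e^ρ − 1`, `0 < ρ ≤ 1∕800`, three permutations `σ₁ σ₂ σ₃`, and ANY `δ` dominating the sup of the differences.  Then, with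
`J₁₄ := mean_i log(e^{a i}e^{b(σ₁i)}e^{c(σ₂σ₁i)}e^{d(σ₃σ₂σ₁i)}H) − mean⁴ log(e^{a i}e^{b j}e^{c k}e^{d l}H)`,
`‖J₁₄(a′,b′,c′,d′,H′) − J₁₄(a,b,c,d,H)‖ ≤ 4096·((e^{24ρ} − 1) + (e^{16ρ} − 1) + (e^{8ρ} − 1))·δ` (`≈ 2·10⁵·ρ·δ`: Lipschitz constant = THE SIZE; NO closeness of the tuples needed —
both lie in the half ball about the IDENTITY tuple, ✓`norm_sub_le_on_half_ball` with the crude bound `norm_chain4_le_of_sizes` at radius `8ρ`). [cite: Balaban1985Averaging, (21) p.21] -/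
theorem norm_chain4_sub_chain4_le (a b c d a' b' c' d' : ι → 𝔸) (H H' : 𝔸) (σ₁ σ₂ σ₃ : Equiv.Perm ι) {ρ δ : ℝ} (hρ0 : 0 < ρ) (hρ : ρ ≤ 1 / 800)
    (ha : ∀ i, ‖a i‖ ≤ ρ) (hb : ∀ i, ‖b i‖ ≤ ρ) (hc : ∀ i, ‖c i‖ ≤ ρ) (hd : ∀ i, ‖d i‖ ≤ ρ) (hH : ‖H - 1‖ ≤ Real.exp ρ - 1)
    (ha' : ∀ i, ‖a' i‖ ≤ ρ) (hb' : ∀ i, ‖b' i‖ ≤ ρ) (hc' : ∀ i, ‖c' i‖ ≤ ρ) (hd' : ∀ i, ‖d' i‖ ≤ ρ) (hH' : ‖H' - 1‖ ≤ Real.exp ρ - 1)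
    (hδ0 : 0 ≤ δ) (hda : ∀ i, ‖a' i - a i‖ ≤ δ) (hdb : ∀ i, ‖b' i - b i‖ ≤ δ) (hdc : ∀ i, ‖c' i - c i‖ ≤ δ) (hdd : ∀ i, ‖d' i - d i‖ ≤ δ)
    (hdH : ‖H' - H‖ ≤ δ) :
    ‖(((Fintype.card ι : ℝ))⁻¹ • ∑ i, mlog (exp (a' i) * exp (b' (σ₁ i)) * exp (c' (σ₂ (σ₁ i))) * exp (d' (σ₃ (σ₂ (σ₁ i)))) * H') -
        ((Fintype.card ι : ℝ))⁻¹ • ∑ i, ((Fintype.card ι : ℝ))⁻¹ • ∑ j, ((Fintype.card ι : ℝ))⁻¹ • ∑ k, ((Fintype.card ι : ℝ))⁻¹ • ∑ l,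
          mlog (exp (a' i) * exp (b' j) * exp (c' k) * exp (d' l) * H')) -
      (((Fintype.card ι : ℝ))⁻¹ • ∑ i, mlog (exp (a i) * exp (b (σ₁ i)) * exp (c (σ₂ (σ₁ i))) * exp (d (σ₃ (σ₂ (σ₁ i)))) * H) -
        ((Fintype.card ι : ℝ))⁻¹ • ∑ i, ((Fintype.card ι : ℝ))⁻¹ • ∑ j, ((Fintype.card ι : ℝ))⁻¹ • ∑ k, ((Fintype.card ι : ℝ))⁻¹ • ∑ l,
          mlog (exp (a i) * exp (b j) * exp (c k) * exp (d l) * H))‖ ≤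
      4096 * ((Real.exp (24 * ρ) - 1) + (Real.exp (16 * ρ) - 1) + (Real.exp (8 * ρ) - 1)) * δ := by
  set J : ((ι → 𝔸) × (ι → 𝔸) × (ι → 𝔸) × (ι → 𝔸) × 𝔸) → 𝔸 := fun p =>
      ((Fintype.card ι : ℝ))⁻¹ • ∑ i, mlog (exp (p.1 i) * exp (p.2.1 (σ₁ i)) * exp (p.2.2.1 (σ₂ (σ₁ i))) * exp (p.2.2.2.1 (σ₃ (σ₂ (σ₁ i)))) * p.2.2.2.2) -
        ((Fintype.card ι : ℝ))⁻¹ • ∑ i, ((Fintype.card ι : ℝ))⁻¹ • ∑ j, ((Fintype.card ι : ℝ))⁻¹ • ∑ k, ((Fintype.card ι : ℝ))⁻¹ • ∑ l,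
          mlog (exp (p.1 i) * exp (p.2.1 j) * exp (p.2.2.1 k) * exp (p.2.2.2.1 l) * p.2.2.2.2) with hJ
  have hρ1 : ρ ≤ 1 := by linarith
  have hp₀ball : ((a, b, c, d, H) : (ι → 𝔸) × (ι → 𝔸) × (ι → 𝔸) × (ι → 𝔸) × 𝔸) ∈
      ball ((0, 0, 0, 0, 1) : (ι → 𝔸) × (ι → 𝔸) × (ι → 𝔸) × (ι → 𝔸) × 𝔸) (8 * ρ / 2) := by
    have h := mem_ball_one_of_sizes (p := ((a, b, c, d, H) : (ι → 𝔸) × (ι → 𝔸) × (ι → 𝔸) × (ι → 𝔸) × 𝔸)) hρ0 hρ1 ha hb hc hd hH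
    rw [mem_ball] at h ⊢; linarith
  have hp₁ball : ((a', b', c', d', H') : (ι → 𝔸) × (ι → 𝔸) × (ι → 𝔸) × (ι → 𝔸) × 𝔸) ∈
      ball ((0, 0, 0, 0, 1) : (ι → 𝔸) × (ι → 𝔸) × (ι → 𝔸) × (ι → 𝔸) × 𝔸) (8 * ρ / 2) := by
    have h := mem_ball_one_of_sizes (p := ((a', b', c', d', H') : (ι → 𝔸) × (ι → 𝔸) × (ι → 𝔸) × (ι → 𝔸) × 𝔸)) hρ0 hρ1 ha' hb' hc' hd' hH'
    rw [mem_ball] at h ⊢; linarith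
  have h0 : ∀ i, ‖(0 : ι → 𝔸) i‖ ≤ 0 := fun i => by simp
  have hdiff : DifferentiableOn ℂ J (ball ((0, 0, 0, 0, 1) : (ι → 𝔸) × (ι → 𝔸) × (ι → 𝔸) × (ι → 𝔸) × 𝔸) (8 * ρ)) :=
    differentiableOn_chain4 (p₀ := ((0, 0, 0, 0, 1) : (ι → 𝔸) × (ι → 𝔸) × (ι → 𝔸) × (ι → 𝔸) × 𝔸)) (ρ := 0) (r := 8 * ρ)
      (by linarith) (by linarith) h0 h0 h0 h0 (by simp) σ₁ σ₂ σ₃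
  have hM : ∀ p ∈ ball ((0, 0, 0, 0, 1) : (ι → 𝔸) × (ι → 𝔸) × (ι → 𝔸) × (ι → 𝔸) × 𝔸) (8 * ρ),
      ‖J p‖ ≤ 1024 * (8 * ρ) * ((Real.exp (3 * (8 * ρ)) - 1) + (Real.exp (2 * (8 * ρ)) - 1) + (Real.exp (8 * ρ) - 1)) := by
    intro p hp
    obtain ⟨ha₈, hb₈, hc₈, hd₈, hH₈⟩ := sizes_on_ball_one hp
    exact norm_chain4_le_of_sizes p.1 p.2.1 p.2.2.1 p.2.2.2.1 p.2.2.2.2 (by linarith) ha₈ hb₈ hc₈ hd₈ hH₈ σ₁ σ₂ σ₃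
  have key := norm_sub_le_on_half_ball hdiff hM hp₁ball hp₀ball
  have hdist : ‖((a', b', c', d', H') : (ι → 𝔸) × (ι → 𝔸) × (ι → 𝔸) × (ι → 𝔸) × 𝔸) - (a, b, c, d, H)‖ ≤ δ := by
    have hpi : ∀ (f g : ι → 𝔸), (∀ i, ‖f i - g i‖ ≤ δ) → ‖f - g‖ ≤ δ := fun f g h =>
      (pi_norm_le_iff_of_nonneg hδ0).mpr fun i => by simpa using h i
    simp only [Prod.mk_sub_mk, Prod.norm_def, max_le_iff]
    exact ⟨hpi _ _ hda, hpi _ _ hdb, hpi _ _ hdc, hpi _ _ hdd, hdH⟩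
  have e1 : 0 ≤ Real.exp (8 * ρ) - 1 := by linarith [Real.add_one_le_exp (8 * ρ)]
  have e2 : 0 ≤ Real.exp (16 * ρ) - 1 := by linarith [Real.add_one_le_exp (16 * ρ)]
  have e3 : 0 ≤ Real.exp (24 * ρ) - 1 := by linarith [Real.add_one_le_exp (24 * ρ)]
  have hcoef : 4 * (1024 * (8 * ρ) * ((Real.exp (3 * (8 * ρ)) - 1) + (Real.exp (2 * (8 * ρ)) - 1) + (Real.exp (8 * ρ) - 1))) / (8 * ρ) =
      4096 * ((Real.exp (24 * ρ) - 1) + (Real.exp (16 * ρ) - 1) + (Real.exp (8 * ρ) - 1)) := by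
    rw [show 3 * (8 * ρ) = 24 * ρ by ring, show 2 * (8 * ρ) = 16 * ρ by ring]
    field_simp
    ring
  rw [hcoef] at key
  have hJ1 : J (a', b', c', d', H') = ((Fintype.card ι : ℝ))⁻¹ • ∑ i, mlog (exp (a' i) * exp (b' (σ₁ i)) * exp (c' (σ₂ (σ₁ i))) * exp (d' (σ₃ (σ₂ (σ₁ i)))) * H') -
        ((Fintype.card ι : ℝ))⁻¹ • ∑ i, ((Fintype.card ι : ℝ))⁻¹ • ∑ j, ((Fintype.card ι : ℝ))⁻¹ • ∑ k, ((Fintype.card ι : ℝ))⁻¹ • ∑ l,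
          mlog (exp (a' i) * exp (b' j) * exp (c' k) * exp (d' l) * H') := rfl
  have hJ0 : J (a, b, c, d, H) = ((Fintype.card ι : ℝ))⁻¹ • ∑ i, mlog (exp (a i) * exp (b (σ₁ i)) * exp (c (σ₂ (σ₁ i))) * exp (d (σ₃ (σ₂ (σ₁ i)))) * H) -
        ((Fintype.card ι : ℝ))⁻¹ • ∑ i, ((Fintype.card ι : ℝ))⁻¹ • ∑ j, ((Fintype.card ι : ℝ))⁻¹ • ∑ k, ((Fintype.card ι : ℝ))⁻¹ • ∑ l,
          mlog (exp (a i) * exp (b j) * exp (c k) * exp (d l) * H) := rfl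
  rw [← hJ1, ← hJ0]
  exact key.trans (mul_le_mul_of_nonneg_left hdist (by positivity))

end Summit.QuantumFields.YangMills.Theorems.FluctuationComparisonRegPrIntLS2BetaRelativeChainCoupling

end
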